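import Literature.NumberTheory.Transcendental.PhilipponCriterionEndgame
import Literature.NumberTheory.Transcendental.PhilipponCriterionInduction
import HarnessLib

/-!
# Philippon's criterion over Nesterenko's toolkit, XVIII: end of the proof — proofs only

`Literature/NumberTheory/Transcendental/PhilipponCriterionFinal.lean` — proofs only (no new
definitions, nothing asserted). "Fin de la démonstration du théorème (2.11)" (Publ. Math. IHÉS 64
(1986), §3, p. 48): by Lemme 2.15 (`mem_minimalPrimes_of_level`) the primes `𝔓_{N,1}` of `(A_1)`
range in a finite set, so one of them, `𝔓`, occurs for arbitrarily large `N`; then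
`|𝔓(ω̄)| ≤ exp(−Λ_1(N) size_N(𝔓)) → 0` forces `|𝔓(ω̄)| = 0`, i.e. `ω̄ ∈ V(𝔓)` (Prop. 4.13), and as
all generators of such a level `N` lie in `𝔓` (`mem_level_of_good`) they all vanish at `ω̄` —
against the hypothesis `max_j |Q_{N,j}(θ)| > 0` of Thm 2.11 ("Ceci contredit l'existence d'une suite
d'idéaux `I_N` satisfaisant l'hypothèse auxiliaire", p. 48; here without Liouville's inequality).

* `Setup.not_large` — the standing data `𝒮 : Setup` with `r₀ ≤ m` are contradictory once `C`
  exceeds the explicit thresholds (in terms of `n, k, θ`) and the levels `N ≥ N₁` satisfy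
  `R(N₀) + log(1/κ) < λ_1 C τ(N)/(2 r₀)`.

## References

* [Philippon1986Criteres] P. Philippon, Publ. Math. IHÉS 64 (1986), §3, p. 48.
* [NesterenkoPhilippon2001] LNM 1752 (2001), Ch. 3 Prop. 4.13 (p. 41).
-/

noncomputable section

open MvPolynomial Real Filter
open Literature.NumberTheory.Transcendental.Nesterenko

attribute [local instance] MvPolynomial.gradedAlgebra

namespace Literature.NumberTheory.Transcendental

namespace PhilipponMain

namespace Setup

variable (𝒮 : Setup)

/-- `|𝔓(ω̄)| = 0` forces `ω̄ ∈ V(𝔓)` for a homogeneous prime of rank `1` (Prop. 4.13 with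
`|I(ω̄)| = 0`: some zero `β̄` has projective distance `0` to `ω̄`, and then `(1 : β̄/β₀) = ω̄`).
[cite: Philippon1986Criteres, §3 p. 48 ("c'est-à-dire `θ ∈ 𝒵(𝔓)`")]
[cite: NesterenkoPhilippon2001, Ch. 3 Prop. 4.13 (p. 41)] -/
theorem ω_mem_projZeros_of_iabs_eq_zero (h44 : NesterenkoPhilippon2001_ch3_prop_4_4)
    (h413 : NesterenkoPhilippon2001_ch3_prop_4_13) {𝔓 : Ideal (Rx 𝒮.m)} (h𝔓 : 𝔓.IsPrime)
    (h𝔓hom : 𝔓.IsHomogeneous (homogeneousSubmodule (Fin (𝒮.m + 1)) ℚ)) (h𝔓unm : IsUnmixedOfRank 𝔓 1)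
    (h0 : iabs 𝔓 1 𝒮.ω = 0) : 𝒮.ω ∈ projZeros 𝔓 := by
  have h𝔓c : ∀ g ∈ 𝔓, ∀ k : ℕ, homogeneousComponent k g ∈ 𝔓 :=
    fun g hg k => homogeneousComponent_mem_of_mem h𝔓hom hg k
  obtain ⟨β, hβ, hd⟩ := h413 𝒮.m 1 𝔓 le_rfl 𝒮.one_le_m h𝔓hom h𝔓unm 𝒮.ω 𝒮.ω_ne_zero
  have hdeg1 : 1 ≤ ideg 𝔓 1 :=
    Literature.Barriers.Schanuel.one_le_ideg_of_isPrime h44 le_rfl 𝒮.one_le_m h𝔓 h𝔓hom h𝔓unm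
  rw [h0, zero_mul, Nat.cast_one, div_one, rpow_one, zero_mul] at hd
  have hd0 : projDist 𝒮.ω β = 0 :=
    pow_eq_zero_iff (n := ideg 𝔓 1) (by omega) |>.mp (le_antisymm hd (pow_nonneg (projDist_nonneg _ _) _))
  have hω : 𝒮.ω = Fin.cons 1 𝒮.θ := rfl
  obtain ⟨hβ0, -, hnear⟩ := affine_near_of_projDist_le 𝒮.θ hβ.1 (by rw [← hω, hd0, zero_mul]; norm_num)
  have hz := cons_one_div_mem_projZeros h𝔓c hβ hβ0
  have e : (fun j : Fin 𝒮.m => β j.succ / β 0) = 𝒮.θ := by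
    funext j
    have := hnear j
    rw [← hω, hd0, mul_zero] at this
    exact sub_eq_zero.mp (norm_le_zero_iff.mp this)
  rwa [e, ← hω] at hz

/-- **End of the proof of Théorème 2.11** (Philippon 1986, §3, p. 48). The standing data
`𝒮 : Setup` with `r₀ ≤ m` are contradictory as soon as `C` is large in terms of `n, k, θ`
(explicit thresholds, with `0 < q ≤ 1`, `c q (1 + B_1 + D₀) ≤ 1`, `λ_1 = q^{r₀−1}`) and
`R(N₀) + log(1/κ) < λ_1 C τ(N)/(2r₀)` for all `N ≥ N₁ ≥ N₀`.
[cite: Philippon1986Criteres, §3, Thm 2.11, "Fin de la démonstration" (p. 48)] -/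
theorem not_large (h44 : NesterenkoPhilippon2001_ch3_prop_4_4)
    (h47 : NesterenkoPhilippon2001_ch3_prop_4_7) (h410 : NesterenkoPhilippon2001_ch3_cor_4_10)
    (h411 : NesterenkoPhilippon2001_ch3_prop_4_11) (h412 : NesterenkoPhilippon2001_ch3_cor_4_12)
    (h413 : NesterenkoPhilippon2001_ch3_prop_4_13) (hr₀m : 𝒮.r₀ ≤ 𝒮.m)
    {q : ℝ} (hq0 : 0 < q) (hq1 : q ≤ 1)
    (hqc : 20 * ((1 + (𝒮.m : ℝ) ^ 2) * (2 + 𝒮.m * (𝒮.k + 3))) * q * (1 + 𝒮.B 1 + 𝒮.D₀) ≤ 1)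
    (hC1 : 2 + 8 * 𝒮.r₀ * (𝒮.m : ℝ) ^ 3 ≤ q ^ (𝒮.r₀ - 1) * 𝒮.C)
    (hC2 : 2 * (1 + 11 * (𝒮.m : ℝ) ^ 2) ≤ q ^ (𝒮.r₀ - 1) * 𝒮.C)
    (hC3 : 10 * (1 + 12 * (𝒮.m : ℝ) ^ 2) ≤ q ^ (𝒮.r₀ - 1) * 𝒮.C)
    (hC4 : 20 * (𝒮.m : ℝ) ^ 3 ≤ q ^ (𝒮.r₀ - 1) * 𝒮.C)
    (hCa : 2 * (1 + 11 * (𝒮.m : ℝ) ^ 2) * (𝒮.B 1 + 𝒮.D₀) ≤ 𝒮.C) (hCb : 2 * (𝒮.m : ℝ) ≤ 𝒮.C)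
    (hCc : log (4 * 𝒮.Θ ^ 2) ≤ 𝒮.C) (hCd : 20 * (𝒮.m : ℝ) ^ 3 * 𝒮.D₀ ≤ 𝒮.C)
    {N₁ : ℕ} (hN₁ : 𝒮.N₀ ≤ N₁)
    (hbig : ∀ N, N₁ ≤ N → 𝒮.R 𝒮.N₀ + log (1 / 𝒮.κ) < q ^ (𝒮.r₀ - 1) * 𝒮.C * 𝒮.τ N / (2 * 𝒮.r₀)) :
    False := by
  classical
  set lam : ℝ := q ^ (𝒮.r₀ - 1) with hlam
  have hlam0 : 0 < lam := by positivity
  have hC := 𝒮.C_pos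
  have hr₀1 := 𝒮.one_le_r₀
  have hr₀R : (1 : ℝ) ≤ 𝒮.r₀ := by exact_mod_cast hr₀1
  have hm1 : (1 : ℝ) ≤ 𝒮.m := by exact_mod_cast 𝒮.one_le_m
  -- `(A_1)` at every level `N ≥ N₁`
  have hG : ∀ N, ∃ 𝔓 : Ideal (Rx 𝒮.m), N₁ ≤ N → 𝒮.Good lam N 1 𝔓 := fun N => by
    by_cases hN : N₁ ≤ N
    · obtain ⟨𝔓, h𝔓⟩ := 𝒮.good_one h44 h47 h410 h411 h412 h413 hr₀m (hN₁.trans hN) hq0 hq1 hqc hC1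
        hC2 hC3 hC4 hCa hCb hCc hCd (hbig N hN)
      exact ⟨𝔓, fun _ => h𝔓⟩
    · exact ⟨⊥, fun h => absurd h hN⟩
  choose 𝔓 h𝔓 using hG
  -- the quality `Λ_1(N) ≥ λ C ξ(N) ≥ λ C` and the hypotheses of Lemme 2.15 at `N ≥ N₁`
  have hΛ : ∀ N, lam * 𝒮.C * 𝒮.ξ N ≤ 𝒮.Λ lam 1 N := fun N => 𝒮.Λ_ge hlam0.le le_rfl hr₀1 N
  have hΛ' : ∀ N, lam * 𝒮.C ≤ 𝒮.Λ lam 1 N := fun N =>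
    le_trans (le_mul_of_one_le_right (by positivity) (𝒮.one_le_ξ N)) (hΛ N)
  have hΛa : ∀ N, 2 + 8 * (𝒮.m : ℝ) ^ 3 ≤ 𝒮.Λ lam 1 N := fun N => by
    have h1 : 8 * (𝒮.m : ℝ) ^ 3 ≤ 8 * 𝒮.r₀ * (𝒮.m : ℝ) ^ 3 := by
      have : 0 ≤ 8 * (𝒮.m : ℝ) ^ 3 := by positivity
      nlinarith
    linarith [hΛ' N]
  have hΛb : ∀ N, 2 * (1 + 11 * (𝒮.m : ℝ) ^ 2) ≤ 𝒮.Λ lam 1 N := fun N => hC2.trans (hΛ' N)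
  have hΛc : ∀ N, 10 * (1 + 12 * (𝒮.m : ℝ) ^ 2) * 𝒮.ξ N ≤ 𝒮.Λ lam 1 N := fun N =>
    le_trans (mul_le_mul_of_nonneg_right hC3 (𝒮.ξ_pos N).le) (hΛ N)
  have hNbig : ∀ N, N₁ ≤ N → 𝒮.R 𝒮.N₀ + log (1 / 𝒮.κ) < 𝒮.Λ lam 1 N * 𝒮.τ N / 2 := fun N hN => by
    refine lt_of_lt_of_le (hbig N hN) ?_
    have hτ := 𝒮.τ_pos N
    rw [div_le_div_iff₀ (by positivity) (by norm_num)]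
    have h1 : lam * 𝒮.C * 𝒮.τ N ≤ 𝒮.Λ lam 1 N * 𝒮.τ N := mul_le_mul_of_nonneg_right (hΛ' N) hτ.le
    have h2 : 0 ≤ 𝒮.Λ lam 1 N * 𝒮.τ N := mul_nonneg (𝒮.Λ_nonneg hlam0.le _ _) hτ.le
    nlinarith
  -- Lemme 2.15: every `𝔓 N`, `N ≥ N₁`, is a minimal prime of the fixed ideal `𝔄`
  set 𝔄 : Ideal (Rx 𝒮.m) := 𝒮.𝔓₀ ⊔ Ideal.span (Set.range (𝒮.E 𝒮.N₀)) with h𝔄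
  have hmin : ∀ N, N₁ ≤ N → 𝔓 N ∈ 𝔄.minimalPrimes := fun N hN => by
    obtain ⟨hb, z, hz, hzθ⟩ := 𝒮.level_min_props h44 h47 h411 h412 h413 hr₀m (hN₁.trans hN) (h𝔓 N hN)
      (hΛa N) (hΛb N) (hΛc N) hCa hCb hCc (hNbig N hN)
    obtain ⟨hp, -, h0, r', hr'1, hr'r, hunm, -⟩ := h𝔓 N hN
    obtain rfl : r' = 1 := le_antisymm hr'r hr'1
    exact 𝒮.mem_minimalPrimes_of_level hp hunm h0 hb hz hzθ
  -- pigeonhole: some `𝔮` occurs as `𝔓 N` for arbitrarily large `N`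
  have hT : 𝔄.minimalPrimes.Finite := 𝔄.finite_minimalPrimes_of_isNoetherianRing
  obtain ⟨𝔮, hfreq⟩ : ∃ 𝔮 : Ideal (Rx 𝒮.m), ∀ L, ∃ N, L ≤ N ∧ N₁ ≤ N ∧ 𝔓 N = 𝔮 := by
    by_contra hno
    push Not at hno
    choose L hL using hno
    set N : ℕ := max N₁ (hT.toFinset.sup L) with hNdef
    have hN1 : N₁ ≤ N := le_max_left _ _
    have hmem : 𝔓 N ∈ hT.toFinset := hT.mem_toFinset.mpr (hmin N hN1)
    have hLN : L (𝔓 N) ≤ N := le_trans (Finset.le_sup hmem) (le_max_right _ _)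
    exact hL (𝔓 N) N hLN hN1 rfl
  -- the facts about `𝔮`
  obtain ⟨N', -, hN'1, hN'𝔮⟩ := hfreq 0
  obtain ⟨h𝔮p, h𝔮hom, -, r', hr'1, hr'r, h𝔮unm, -⟩ := h𝔓 N' hN'1
  obtain rfl : r' = 1 := le_antisymm hr'r hr'1
  rw [hN'𝔮] at h𝔮p h𝔮hom h𝔮unm
  have hdeg1 : 1 ≤ ideg 𝔮 1 :=
    Literature.Barriers.Schanuel.one_le_ideg_of_isPrime h44 le_rfl 𝒮.one_le_m h𝔮p h𝔮hom h𝔮unm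
  -- `|𝔮(ω̄)| ≤ exp(−λ C τ(N))` for arbitrarily large `N`, hence `|𝔮(ω̄)| = 0`
  have hsmallN : ∀ N, N₁ ≤ N → 𝔓 N = 𝔮 → iabs 𝔮 1 𝒮.ω ≤ exp (-(lam * 𝒮.C * 𝒮.τ N)) := by
    intro N hN hN𝔮
    obtain ⟨-, -, -, r', hr'1, hr'r, -, -, -, hsmall⟩ := h𝔓 N hN
    obtain rfl : r' = 1 := le_antisymm hr'r hr'1
    rw [hN𝔮] at hsmall
    refine hsmall.trans (exp_le_exp.mpr (neg_le_neg ?_))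
    have h1 : 𝒮.τ N ≤ 𝒮.size N 𝔮 1 := by
      have h2 : 𝒮.τ N ≤ 𝒮.τ N * ideg 𝔮 1 :=
        le_mul_of_one_le_right (𝒮.τ_pos N).le (by exact_mod_cast hdeg1)
      exact h2.trans (𝒮.τ_mul_ideg_le_size N 𝔮 1)
    calc lam * 𝒮.C * 𝒮.τ N ≤ lam * 𝒮.C * 𝒮.size N 𝔮 1 := mul_le_mul_of_nonneg_left h1 (by positivity)
      _ ≤ 𝒮.Λ lam 1 N * 𝒮.size N 𝔮 1 := mul_le_mul_of_nonneg_right (hΛ' N) (𝒮.size_nonneg N 𝔮 1)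
  have hiabs0 : iabs 𝔮 1 𝒮.ω = 0 := by
    by_contra hne
    have hpos : 0 < iabs 𝔮 1 𝒮.ω := lt_of_le_of_ne (iabs_nonneg _ _ _) (Ne.symm hne)
    -- a level with `τ N ≥ T₀`, `exp(−λ C T₀) < |𝔮(ω̄)|`
    set T₀ : ℝ := (log (1 / iabs 𝔮 1 𝒮.ω) + 1) / (lam * 𝒮.C) with hT₀
    have hτT : ∀ᶠ N in atTop, T₀ ≤ 𝒮.τ N := (tendsto_atTop.mp 𝒮.tendsto_τ) T₀
    obtain ⟨L₀, hL₀⟩ := eventually_atTop.mp hτT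
    obtain ⟨N, hNL, hN1, hN𝔮⟩ := hfreq L₀
    have h1 := hsmallN N hN1 hN𝔮
    have h2 : lam * 𝒮.C * T₀ = log (1 / iabs 𝔮 1 𝒮.ω) + 1 := by
      rw [hT₀]; field_simp
    have h3 : exp (-(lam * 𝒮.C * 𝒮.τ N)) ≤ exp (-(lam * 𝒮.C * T₀)) := by
      rw [exp_le_exp, neg_le_neg_iff]
      exact mul_le_mul_of_nonneg_left (hL₀ N hNL) (by positivity)
    have h4 : exp (-(lam * 𝒮.C * T₀)) < iabs 𝔮 1 𝒮.ω := by
      rw [h2, one_div, log_inv, neg_add, neg_neg, exp_add, exp_log hpos]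
      have : exp (-1) < 1 := exp_lt_one_iff.mpr (by norm_num)
      nlinarith
    linarith
  -- hence `ω̄ ∈ V(𝔮)`, and all generators of a level `N ≥ N₁` with `𝔓 N = 𝔮` vanish at `ω̄`
  have hωV := 𝒮.ω_mem_projZeros_of_iabs_eq_zero h44 h413 h𝔮p h𝔮hom h𝔮unm hiabs0
  obtain ⟨N, -, hN1, hN𝔮⟩ := hfreq 0
  have hN0 : 𝒮.N₀ ≤ N := hN₁.trans hN1
  obtain ⟨j, hj⟩ := 𝒮.exists_not_mem N hN0
  apply hj
  have hmem : 𝒮.E N j ∈ 𝔮 := hN𝔮 ▸ 𝒮.mem_level_of_good h44 h411 hN0 (h𝔓 N hN1) (hΛb N) hCa j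
  exact (mem_coneIdeal_iff_of_isHomogeneous (𝒮.isHomogeneous_E N j) _).mpr (hωV.2 _ hmem)

end Setup

end PhilipponMain

end Literature.NumberTheory.Transcendental

end
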